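import Summits.AtomisticToContinuum.HydrodynamicLimit.Theorems.StiffCollisionalRelaxationAprioriBoundsMesoOccupationInProb
import Summits.AtomisticToContinuum.HydrodynamicLimit.Theorems.StiffCollisionalRelaxationAprioriBoundsMesoOccupationVarianceEquilibrium
import Summits.AtomisticToContinuum.HydrodynamicLimit.Theorems.AntiMazurCoboundariesShearStressHalfDrudeRelabel
import Summits.AtomisticToContinuum.HydrodynamicLimit.Theorems.OneFlightGossipEngineCollisionActivityTailsNearFieldKineticMeasurable
import HarnessLib

/-!
# Exchangeability glue of the (i)-half: `Var occ_K → 0` iff the tail sojourns of two tagged spheres decorrelate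
(stub `stub_occupationVariance_of_pairDecorrelation` of the line `meso-chebyshev-window` for the crux `AprioriBounds`,
stmt-AtomisticToContinuum-14827 — registered stub 7 of the r3 skeleton; with its converse and the equilibrium rung
of stub 6 `stub_pairDecorrelation`)

`P_N = localGibbsLaw σ a₀ u₀ θ₀ N (Φ N)` (`σ ≤ 1/2`: probability laws), nice profiles, `t ≥ 0`, ANY flow, an
observable `0 ≤ g ≤ 1`; `ζᵢ(z) := ∫₀ᵗ g((Φ_s z)ᵢ) ds ∈ [0, t]` is the SOJOURN functional of sphere `i`
(`g = 𝟙{K ≤ |v|²}`: the tail sojourns of the skeleton), `occ_K = ∫₀ᵗ frac_K(Φ_s ·) ds = ∫₀ᵗ (N+1)⁻¹∑ᵢ g ds`.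
§1 (pure probability) BIENAYMÉ FOR AN EXCHANGEABLE ROW: if `∫ G(k ↦ X_{π k}) dμ = ∫ G(X) dμ` for all `π`, `G`,
then means/variances of all `Xᵢ` agree, covariances of DISTINCT pairs agree (`moments_of_perm_invariant`), and
`Var((N+1)⁻¹∑ᵢ Xᵢ) = (Var X₀ + N·Cov(X₀, X₁))/(N+1)` (`variance_avg_of_perm_invariant`; at `N = 0` the factor `N`
kills the degenerate pair term).  §2 WINDOW EXCHANGEABILITY OF THE SOJOURNS (`integral_sojourn_perm`):
relabelling preserves `P_N` (`EvenStressEnskog.integral_comp_perm_localGibbsLaw`) and commutes with the flow at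
all forward times simultaneously, `P_N`-a.e. (`ShearStressHalfDrudeRelabel.ae_forall_flow_comp_perm_of_nonneg_…`);
`occ = (N+1)⁻¹∑ᵢ ζᵢ` on good orbits (`occ_eq_avg_sojourn`).  §3 THE IDENTITY
`Var occ_K = (Var ζ₀ + N·Cov(ζ₀, ζ₁))/(N+1)` (`variance_occ_eq_diag_add_cov`), hence
`Var occ_K ≤ t²/(4(N+1)) + |Cov(ζ₀, ζ₁)|` (Popoviciu) and the STUB; conversely `|Cov| ≤ 2·Var occ_K + t²/(4N)`
(`N ≥ 1`), so `Var occ_K → 0 ⟹ Cov(ζ₀, ζ₁) → 0` (`pairDecorrelation_of_occupationVariance`), and the EQUILIBRIUM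
RUNG of stub 6 for every flow family (`pairDecorrelation_homogeneous`, from `occupationVariance_tendsto_const`).

No new definitions, no named facts; axioms `propext`, `Classical.choice`, `Quot.sound`.
-/

noncomputable section

open MeasureTheory ProbabilityTheory Filter Set Topology
open scoped ENNReal

namespace Summit.AtomisticToContinuum.HydrodynamicLimit.Theorems.MesoChebyshevWindow

open Literature.MathematicalPhysics.KineticTheory Literature.Analysis.FluidPDE
open Summit.AtomisticToContinuum.HydrodynamicLimit.Theorems.VisitLedgerUpscattering (Cfg Flow Flows NiceProfiles)
open Summit.AtomisticToContinuum.HydrodynamicLimit.Theorems.FibreDeficitTransfer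
open Summit.AtomisticToContinuum.HydrodynamicLimit.Theorems.CollisionActivityTailsNearFieldKineticTails
  (localGibbsLaw_compl_good)

/-! ## §1 Bienaymé for an exchangeable row (pure probability) -/

/-- For distinct labels `i ≠ j` of `Fin (N + 1)` there is a permutation with `π 0 = i`, `π 1 = j`. -/
theorem exists_perm_apply_zero_one {N : ℕ} {i j : Fin (N + 1)} (hij : i ≠ j) :
    ∃ π : Equiv.Perm (Fin (N + 1)), π 0 = i ∧ π 1 = j := by
  haveI : NeZero N := ⟨by rintro rfl; exact hij (Fin.ext (by have := j.isLt; have := i.isLt; omega))⟩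
  have h01 : (0 : Fin (N + 1)) ≠ 1 := Fin.zero_ne_one'
  have hj0 : Equiv.swap 0 i j ≠ 0 := fun h => hij (by
    have h' := congrArg (Equiv.swap 0 i) h
    rwa [Equiv.swap_apply_self, Equiv.swap_apply_left, eq_comm] at h')
  refine ⟨(Equiv.swap 1 (Equiv.swap 0 i j)).trans (Equiv.swap 0 i), ?_, ?_⟩
  · rw [Equiv.trans_apply, Equiv.swap_apply_of_ne_of_ne h01 hj0.symm, Equiv.swap_apply_left]
  · rw [Equiv.trans_apply, Equiv.swap_apply_left, Equiv.swap_apply_self]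

/-- **Moments of an exchangeable row**: if the joint law of `(X_{π k})_k` does not depend on `π` (tested against
every `G`), all means equal `E X₀`, all variances `Var X₀`, all covariances of DISTINCT pairs `Cov(X₀, X₁)`. -/
theorem moments_of_perm_invariant {Ω : Type*} [MeasurableSpace Ω] {μ : Measure Ω} {N : ℕ}
    {X : Fin (N + 1) → Ω → ℝ} (hX : ∀ i, AEMeasurable (X i) μ)
    (hex : ∀ (π : Equiv.Perm (Fin (N + 1))) (G : (Fin (N + 1) → ℝ) → ℝ),
      ∫ ω, G (fun k => X (π k) ω) ∂μ = ∫ ω, G (fun k => X k ω) ∂μ) :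
    (∀ i, ∫ ω, X i ω ∂μ = ∫ ω, X 0 ω ∂μ) ∧ (∀ i, Var[X i; μ] = Var[X 0; μ]) ∧
      ∀ i j, i ≠ j → cov[X i, X j; μ] = cov[X 0, X 1; μ] := by
  have hmean : ∀ i, ∫ ω, X i ω ∂μ = ∫ ω, X 0 ω ∂μ := fun i => by
    simpa only [Equiv.swap_apply_left] using hex (Equiv.swap 0 i) (fun v => v 0)
  refine ⟨hmean, fun i => ?_, fun i j hij => ?_⟩
  · rw [variance_eq_integral (hX i), variance_eq_integral (hX 0), hmean i]
    simpa only [Equiv.swap_apply_left] using hex (Equiv.swap 0 i) (fun v => (v 0 - ∫ ω, X 0 ω ∂μ) ^ 2)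
  · obtain ⟨π, hπ0, hπ1⟩ := exists_perm_apply_zero_one hij
    have h := hex π (fun v => (v 0 - ∫ ω, X 0 ω ∂μ) * (v 1 - ∫ ω, X 0 ω ∂μ))
    simp only [hπ0, hπ1] at h
    simp only [covariance]
    rw [hmean i, hmean j, hmean 1]
    exact h

/-- **Bienaymé for an exchangeable row** `X₀, …, X_N ∈ L²` of a probability space:
`Var((N+1)⁻¹∑ᵢ Xᵢ) = (Var X₀ + N·Cov(X₀, X₁))/(N+1)` (`N+1` diagonal terms `Var X₀`, `(N+1)N` off-diagonal). -/
theorem variance_avg_of_perm_invariant {Ω : Type*} [MeasurableSpace Ω] {μ : Measure Ω} [IsProbabilityMeasure μ]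
    {N : ℕ} {X : Fin (N + 1) → Ω → ℝ} (hX : ∀ i, MemLp (X i) 2 μ)
    (hex : ∀ (π : Equiv.Perm (Fin (N + 1))) (G : (Fin (N + 1) → ℝ) → ℝ),
      ∫ ω, G (fun k => X (π k) ω) ∂μ = ∫ ω, G (fun k => X k ω) ∂μ) :
    Var[fun ω => ((N + 1 : ℕ) : ℝ)⁻¹ * ∑ i, X i ω; μ] =
      (Var[X 0; μ] + (N : ℝ) * cov[X 0, X 1; μ]) / ((N + 1 : ℕ) : ℝ) := by
  obtain ⟨-, hdiag, hoff⟩ := moments_of_perm_invariant (fun i => (hX i).aemeasurable) hex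
  rw [variance_const_mul, variance_fun_sum hX]
  have hrow : ∀ i, ∑ j, cov[X i, X j; μ] = Var[X 0; μ] + (N : ℝ) * cov[X 0, X 1; μ] := by
    intro i
    rw [← Finset.add_sum_erase _ _ (Finset.mem_univ i), covariance_self (hX i).aemeasurable, hdiag i,
      Finset.sum_congr rfl fun j hj => hoff i j (Finset.ne_of_mem_erase hj).symm, Finset.sum_const,
      Finset.card_erase_of_mem (Finset.mem_univ i), Finset.card_univ, Fintype.card_fin, Nat.add_sub_cancel,
      nsmul_eq_mul]
  simp only [hrow, Finset.sum_const, Finset.card_univ, Fintype.card_fin, nsmul_eq_mul]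
  have hn : ((N + 1 : ℕ) : ℝ) ≠ 0 := by positivity
  rw [div_eq_inv_mul, pow_two, mul_assoc, inv_mul_cancel_left₀ hn]

/-- From the Bienaymé identity `W = (V + N c)/(N+1)` with `V ≤ t²/4`: `W ≤ t²/(4(N+1)) + |c|`. -/
theorem le_of_avg_identity {W V c t : ℝ} {N : ℕ} (hid : W = (V + (N : ℝ) * c) / ((N + 1 : ℕ) : ℝ))
    (hV : V ≤ t ^ 2 / 4) : W ≤ t ^ 2 / (4 * ((N + 1 : ℕ) : ℝ)) + |c| := by
  have hn : (0 : ℝ) < ((N + 1 : ℕ) : ℝ) := by positivity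
  have hNc : (N : ℝ) * c ≤ ((N + 1 : ℕ) : ℝ) * |c| := by
    push_cast
    nlinarith [le_abs_self c, abs_nonneg c, (Nat.cast_nonneg N : (0 : ℝ) ≤ N)]
  rw [hid]
  calc (V + (N : ℝ) * c) / ((N + 1 : ℕ) : ℝ)
      ≤ (t ^ 2 / 4 + ((N + 1 : ℕ) : ℝ) * |c|) / ((N + 1 : ℕ) : ℝ) :=
        div_le_div_of_nonneg_right (add_le_add hV hNc) hn.le
    _ = t ^ 2 / (4 * ((N + 1 : ℕ) : ℝ)) + |c| := by rw [add_div, mul_div_cancel_left₀ _ hn.ne', div_div]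

/-- From `W = (V + N c)/(N+1)`, `0 ≤ W`, `0 ≤ V ≤ t²/4`, `N ≥ 1`: `|c| ≤ 2 W + t²/(4N)` (`N c = (N+1) W − V`). -/
theorem abs_le_of_avg_identity {W V c t : ℝ} {N : ℕ} (hN : 1 ≤ N)
    (hid : W = (V + (N : ℝ) * c) / ((N + 1 : ℕ) : ℝ)) (hW : 0 ≤ W) (hV0 : 0 ≤ V) (hV : V ≤ t ^ 2 / 4) :
    |c| ≤ 2 * W + t ^ 2 / (4 * (N : ℝ)) := by
  have hN1 : (1 : ℝ) ≤ N := by exact_mod_cast hN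
  have hNpos : (0 : ℝ) < N := by linarith
  have hNne : (N : ℝ) ≠ 0 := hNpos.ne'
  have hn : (N : ℝ) + 1 ≠ 0 := by positivity
  have hmul : ((N : ℝ) + 1) * W = V + N * c := by rw [hid]; push_cast; field_simp
  have hs : (N : ℝ) * (t ^ 2 / (4 * N)) = t ^ 2 / 4 := by field_simp
  have h1 : 0 ≤ (N : ℝ) * W := mul_nonneg hNpos.le hW
  have h2 : 0 ≤ ((N : ℝ) - 1) * W := mul_nonneg (by linarith) hW
  have key : (N : ℝ) * |c| ≤ N * (2 * W + t ^ 2 / (4 * N)) := by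
    rw [mul_add, hs]
    rcases le_or_gt 0 c with hc | hc
    · rw [abs_of_nonneg hc]; nlinarith [sq_nonneg t]
    · rw [abs_of_neg hc]; nlinarith [sq_nonneg t]
  exact le_of_mul_le_mul_left key hNpos

/-! ## §2 Sojourn functionals: bounds, measurability, window exchangeability, `occ` as their average -/

/-- The one-particle tail indicator `𝟙{K ≤ |v|²}` is measurable. -/
theorem measurable_tailInd (K : ℝ) : Measurable fun y : T3 × V3 => if K ≤ ‖y.2‖ ^ 2 then (1 : ℝ) else 0 :=
  Measurable.ite (measurableSet_le measurable_const (measurable_snd.norm.pow_const 2)) measurable_const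
    measurable_const

/-- The tail indicator takes values in `[0, 1]`. -/
theorem tailInd_mem_Icc (K : ℝ) (y : T3 × V3) : (if K ≤ ‖y.2‖ ^ 2 then (1 : ℝ) else 0) ∈ Icc (0 : ℝ) 1 := by
  split_ifs <;> norm_num

/-- A sojourn functional `ζᵢ(z) = ∫₀ᵗ g((Φ_s z)ᵢ) ds` (`g ≤ 1`, `t ≥ 0`) lies in `[0, t]` at EVERY phase point. -/
theorem sojourn_mem_Icc {σ : ℝ} {N : ℕ} (Φ : Flow σ N) {g : T3 × V3 → ℝ} (hg1 : ∀ y, g y ≤ 1) {t : ℝ}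
    (ht : 0 ≤ t) (z : Cfg N) (i : Fin (N + 1)) :
    (∫⁻ s in Icc 0 t, ENNReal.ofReal (g (Φ.flow s z i))).toReal ∈ Icc 0 t := by
  refine ⟨ENNReal.toReal_nonneg, ENNReal.toReal_le_of_le_ofReal ht ?_⟩
  calc (∫⁻ s in Icc 0 t, ENNReal.ofReal (g (Φ.flow s z i))) ≤ ∫⁻ _ in Icc 0 t, (1 : ℝ≥0∞) :=
        lintegral_mono fun s => ENNReal.ofReal_le_one.2 (hg1 _)
    _ = ENNReal.ofReal t := by rw [setLIntegral_one, Real.volume_Icc, sub_zero]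

/-- Sojourn functionals of a measurable `g` are a.e. measurable for every law carried by the good set
(`AdiabatCeiling.aemeasurable_comp_flow_prod` and Tonelli). -/
theorem aemeasurable_sojourn {σ : ℝ} {N : ℕ} (Φ : Flow σ N) {g : T3 × V3 → ℝ} (hgm : Measurable g) (t : ℝ)
    {P : Measure (Cfg N)} (hP : P Φ.goodᶜ = 0) (i : Fin (N + 1)) :
    AEMeasurable (fun z => (∫⁻ s in Icc 0 t, ENNReal.ofReal (g (Φ.flow s z i))).toReal) P :=
  ((AdiabatCeiling.aemeasurable_comp_flow_prod Φ (H := fun w => ENNReal.ofReal (g (w i)))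
    ((hgm.comp (measurable_pi_apply i)).ennreal_ofReal) hP
    (volume.restrict (Icc 0 t))).lintegral_prod_right').ennreal_toReal

/-- Sojourn functionals of a measurable `g ≤ 1` are in `L²` of every finite law carried by the good set. -/
theorem memLp_sojourn {σ : ℝ} {N : ℕ} (Φ : Flow σ N) {g : T3 × V3 → ℝ} (hgm : Measurable g)
    (hg1 : ∀ y, g y ≤ 1) {t : ℝ} (ht : 0 ≤ t) {P : Measure (Cfg N)} [IsFiniteMeasure P]
    (hP : P Φ.goodᶜ = 0) (i : Fin (N + 1)) :
    MemLp (fun z => (∫⁻ s in Icc 0 t, ENNReal.ofReal (g (Φ.flow s z i))).toReal) 2 P :=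
  memLp_of_bounded (a := 0) (b := t) (ae_of_all _ fun z => sojourn_mem_Icc Φ hg1 ht z i)
    (aemeasurable_sojourn Φ hgm t hP i).aestronglyMeasurable 2

/-- Popoviciu: a sojourn functional (values in `[0, t]`) has variance `≤ t²/4` (law carried by the good set). -/
theorem variance_sojourn_le {σ : ℝ} {N : ℕ} (Φ : Flow σ N) {g : T3 × V3 → ℝ} (hgm : Measurable g)
    (hg1 : ∀ y, g y ≤ 1) {t : ℝ} (ht : 0 ≤ t) {P : Measure (Cfg N)} [IsProbabilityMeasure P]
    (hP : P Φ.goodᶜ = 0) (i : Fin (N + 1)) :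
    Var[fun z => (∫⁻ s in Icc 0 t, ENNReal.ofReal (g (Φ.flow s z i))).toReal; P] ≤ t ^ 2 / 4 :=
  (variance_le_sq_of_bounded (ae_of_all _ fun z => sojourn_mem_Icc Φ hg1 ht z i)
    (aemeasurable_sojourn Φ hgm t hP i)).trans_eq (by ring)

/-- **Window exchangeability of the sojourns** under the local Gibbs law (all profiles, every flow, `π`, `G`, `g`,
`t`): `∫ G(k ↦ ζ_{π k}(z)) dP_N = ∫ G(k ↦ ζ_k(z)) dP_N` — `ζ_{π k}(z) = ζ_k(z ∘ π)` `P_N`-a.e. (the flow commutes with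
relabelling at all `s ≥ 0` simultaneously, `ShearStressHalfDrudeRelabel.ae_forall_flow_comp_perm_of_nonneg_…`) and
relabelling preserves `P_N` (`EvenStressEnskog.integral_comp_perm_localGibbsLaw`). -/
theorem integral_sojourn_perm (σ : ℝ) (a₀ θ₀ : T3 → ℝ) (u₀ : T3 → V3) (N : ℕ) (Φ : Flow σ N)
    (g : T3 × V3 → ℝ) (t : ℝ) (π : Equiv.Perm (Fin (N + 1))) (G : (Fin (N + 1) → ℝ) → ℝ) :
    ∫ z, G (fun k => (∫⁻ s in Icc 0 t, ENNReal.ofReal (g (Φ.flow s z (π k)))).toReal)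
        ∂(localGibbsLaw σ a₀ u₀ θ₀ N Φ) =
      ∫ z, G (fun k => (∫⁻ s in Icc 0 t, ENNReal.ofReal (g (Φ.flow s z k))).toReal)
        ∂(localGibbsLaw σ a₀ u₀ θ₀ N Φ) := by
  calc ∫ z, G (fun k => (∫⁻ s in Icc 0 t, ENNReal.ofReal (g (Φ.flow s z (π k)))).toReal)
        ∂(localGibbsLaw σ a₀ u₀ θ₀ N Φ)
      = ∫ z, G (fun k => (∫⁻ s in Icc 0 t, ENNReal.ofReal (g (Φ.flow s (z ∘ π) k))).toReal)
          ∂(localGibbsLaw σ a₀ u₀ θ₀ N Φ) := by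
        refine integral_congr_ae ?_
        filter_upwards [ShearStressHalfDrudeRelabel.ae_forall_flow_comp_perm_of_nonneg_localGibbsLaw
          σ a₀ θ₀ u₀ N Φ π] with z hz
        have hk : ∀ k, (∫⁻ s in Icc 0 t, ENNReal.ofReal (g (Φ.flow s z (π k)))) =
            ∫⁻ s in Icc 0 t, ENNReal.ofReal (g (Φ.flow s (z ∘ π) k)) := fun k =>
          setLIntegral_congr_fun measurableSet_Icc fun s hs => by
            rw [hz s hs.1]
            rfl
        simp only [hk]
    _ = ∫ z, G (fun k => (∫⁻ s in Icc 0 t, ENNReal.ofReal (g (Φ.flow s z k))).toReal)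
          ∂(localGibbsLaw σ a₀ u₀ θ₀ N Φ) :=
        EvenStressEnskog.integral_comp_perm_localGibbsLaw σ a₀ θ₀ u₀ N Φ π fun w =>
          G (fun k => (∫⁻ s in Icc 0 t, ENNReal.ofReal (g (Φ.flow s w k))).toReal)

/-- **`occ = (N+1)⁻¹∑ᵢ ζᵢ` on good orbits** (measurable `0 ≤ g ≤ 1`; a good orbit `s ↦ Φ_s z` is measurable,
`IsHardSphereTrajectory.measurable_torus`, so Tonelli for the finite sum applies; every sojourn is finite). -/
theorem occ_eq_avg_sojourn {σ : ℝ} {N : ℕ} (Φ : Flow σ N) {g : T3 × V3 → ℝ} (hgm : Measurable g)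
    (hg0 : ∀ y, 0 ≤ g y) (hg1 : ∀ y, g y ≤ 1) (t : ℝ) {z : Cfg N} (hz : z ∈ Φ.good) :
    (∫⁻ s in Icc 0 t, ENNReal.ofReal (((N + 1 : ℕ) : ℝ)⁻¹ * ∑ i, g (Φ.flow s z i))).toReal =
      ((N + 1 : ℕ) : ℝ)⁻¹ * ∑ i, (∫⁻ s in Icc 0 t, ENNReal.ofReal (g (Φ.flow s z i))).toReal := by
  have horb : Measurable fun s => Φ.flow s z := (Φ.isTrajectory z hz).measurable_torus
  have hmeas : ∀ i, Measurable fun s => ENNReal.ofReal (g (Φ.flow s z i)) := fun i =>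
    (hgm.comp ((measurable_pi_apply i).comp horb)).ennreal_ofReal
  have hfin : ∀ i, (∫⁻ s in Icc 0 t, ENNReal.ofReal (g (Φ.flow s z i))) ≠ ∞ := fun i => by
    refine ne_top_of_le_ne_top (b := ∫⁻ _ in Icc 0 t, (1 : ℝ≥0∞)) ?_
      (lintegral_mono fun s => ENNReal.ofReal_le_one.2 (hg1 _))
    rw [setLIntegral_one, Real.volume_Icc]
    exact ENNReal.ofReal_ne_top
  have hn : (0 : ℝ) ≤ ((N + 1 : ℕ) : ℝ)⁻¹ := by positivity
  have hsum : ∀ w : Cfg N, ENNReal.ofReal (((N + 1 : ℕ) : ℝ)⁻¹ * ∑ i, g (w i)) =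
      ENNReal.ofReal (((N + 1 : ℕ) : ℝ)⁻¹) * ∑ i, ENNReal.ofReal (g (w i)) := fun w => by
    rw [ENNReal.ofReal_mul hn, ENNReal.ofReal_sum_of_nonneg fun i _ => hg0 (w i)]
  simp_rw [hsum]
  rw [lintegral_const_mul' _ _ ENNReal.ofReal_ne_top, lintegral_finsetSum _ fun i _ => hmeas i,
    ENNReal.toReal_mul, ENNReal.toReal_ofReal hn, ENNReal.toReal_sum fun i _ => hfin i]

/-! ## §3 The identity, the stub, its converse and the equilibrium rung -/

/-- **Bienaymé along the evolved local Gibbs law** (`σ ≤ 1/2`, nice profiles, every flow, measurable `0 ≤ g ≤ 1`,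
`t ≥ 0`): `Var_{P_N}(∫₀ᵗ (N+1)⁻¹∑ᵢ g((Φ_s ·)ᵢ) ds) = (Var_{P_N} ζ₀ + N·Cov_{P_N}(ζ₀, ζ₁))/(N+1)` (`occ = (N+1)⁻¹∑ᵢ ζᵢ`
a.e.; the row `(ζᵢ)` is exchangeable, `integral_sojourn_perm`; `variance_avg_of_perm_invariant`). -/
theorem variance_occAvg_eq {σ : ℝ} {a₀ θ₀ : T3 → ℝ} {u₀ : T3 → V3} (hnp : NiceProfiles a₀ θ₀ u₀)
    (hσ2 : σ ≤ 1 / 2) (N : ℕ) (Φ : Flow σ N) {g : T3 × V3 → ℝ} (hgm : Measurable g) (hg0 : ∀ y, 0 ≤ g y)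
    (hg1 : ∀ y, g y ≤ 1) {t : ℝ} (ht : 0 ≤ t) :
    Var[fun z => (∫⁻ s in Icc 0 t, ENNReal.ofReal (((N + 1 : ℕ) : ℝ)⁻¹ * ∑ i, g (Φ.flow s z i))).toReal;
        localGibbsLaw σ a₀ u₀ θ₀ N Φ] =
      (Var[fun z => (∫⁻ s in Icc 0 t, ENNReal.ofReal (g (Φ.flow s z 0))).toReal; localGibbsLaw σ a₀ u₀ θ₀ N Φ] +
        (N : ℝ) * cov[fun z => (∫⁻ s in Icc 0 t, ENNReal.ofReal (g (Φ.flow s z 0))).toReal,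
          fun z => (∫⁻ s in Icc 0 t, ENNReal.ofReal (g (Φ.flow s z 1))).toReal; localGibbsLaw σ a₀ u₀ θ₀ N Φ]) /
        ((N + 1 : ℕ) : ℝ) := by
  obtain ⟨ha, hθ, hu, ha0, hθ0⟩ := hnp
  set P : Measure (Cfg N) := localGibbsLaw σ a₀ u₀ θ₀ N Φ with hP
  haveI : IsProbabilityMeasure P := isProbabilityMeasure_localGibbsLaw ha hθ hu ha0 hθ0 hσ2 N Φ
  have hgood : P Φ.goodᶜ = 0 := localGibbsLaw_compl_good σ a₀ θ₀ u₀ N Φ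
  set ζ : Fin (N + 1) → Cfg N → ℝ := fun i z => (∫⁻ s in Icc 0 t, ENNReal.ofReal (g (Φ.flow s z i))).toReal
    with hζ
  have hmem : ∀ i, MemLp (ζ i) 2 P := fun i => memLp_sojourn Φ hgm hg1 ht hgood i
  have hex : ∀ (π : Equiv.Perm (Fin (N + 1))) (G : (Fin (N + 1) → ℝ) → ℝ),
      ∫ z, G (fun k => ζ (π k) z) ∂P = ∫ z, G (fun k => ζ k z) ∂P := fun π G =>
    integral_sojourn_perm σ a₀ θ₀ u₀ N Φ g t π G
  have havg : (fun z => (∫⁻ s in Icc 0 t, ENNReal.ofReal (((N + 1 : ℕ) : ℝ)⁻¹ * ∑ i, g (Φ.flow s z i))).toReal)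
      =ᵐ[P] fun z => ((N + 1 : ℕ) : ℝ)⁻¹ * ∑ i, ζ i z := by
    filter_upwards [(mem_ae_iff.2 hgood : ∀ᵐ z ∂P, z ∈ Φ.good)] with z hz
    exact occ_eq_avg_sojourn Φ hgm hg0 hg1 t hz
  rw [variance_congr havg]
  exact variance_avg_of_perm_invariant hmem hex

/-- **x1 · THE IDENTITY `Var occ_K = (Var ζ₀ + N·Cov(ζ₀, ζ₁))/(N+1)`** for `occ_K = ∫₀ᵗ frac_K(Φ_s ·) ds` and the tail
sojourns `ζᵢ = ∫₀ᵗ 𝟙{K ≤ |vᵢ(s)|²} ds` of spheres `0`, `1`, under `localGibbsLaw σ a₀ u₀ θ₀ N Φ` (`σ ≤ 1/2`, nice profiles,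
EVERY flow, `t ≥ 0`, every `K`, `N`; at `N = 0` it reads `Var occ_K = Var ζ₀`). -/
theorem variance_occ_eq_diag_add_cov {σ : ℝ} {a₀ θ₀ : T3 → ℝ} {u₀ : T3 → V3} (hnp : NiceProfiles a₀ θ₀ u₀)
    (hσ2 : σ ≤ 1 / 2) (N : ℕ) (Φ : Flow σ N) {t : ℝ} (ht : 0 ≤ t) (K : ℝ) :
    Var[fun z => (∫⁻ s in Icc 0 t, ENNReal.ofReal (frac K (Φ.flow s z))).toReal; localGibbsLaw σ a₀ u₀ θ₀ N Φ] =
      (Var[fun z => (∫⁻ s in Icc 0 t,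
          ENNReal.ofReal (if K ≤ ‖(Φ.flow s z 0).2‖ ^ 2 then (1 : ℝ) else 0)).toReal; localGibbsLaw σ a₀ u₀ θ₀ N Φ] +
        (N : ℝ) * cov[fun z => (∫⁻ s in Icc 0 t,
            ENNReal.ofReal (if K ≤ ‖(Φ.flow s z 0).2‖ ^ 2 then (1 : ℝ) else 0)).toReal,
          fun z => (∫⁻ s in Icc 0 t,
            ENNReal.ofReal (if K ≤ ‖(Φ.flow s z 1).2‖ ^ 2 then (1 : ℝ) else 0)).toReal; localGibbsLaw σ a₀ u₀ θ₀ N Φ]) /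
        ((N + 1 : ℕ) : ℝ) := by
  have hfun : (fun z => (∫⁻ s in Icc 0 t, ENNReal.ofReal (frac K (Φ.flow s z))).toReal) =
      fun z => (∫⁻ s in Icc 0 t, ENNReal.ofReal (((N + 1 : ℕ) : ℝ)⁻¹ *
        ∑ i, (fun y : T3 × V3 => if K ≤ ‖y.2‖ ^ 2 then (1 : ℝ) else 0) (Φ.flow s z i))).toReal := by
    funext z
    simp only [frac_eq_avg]
  rw [hfun]
  exact variance_occAvg_eq hnp hσ2 N Φ (measurable_tailInd K) (fun y => (tailInd_mem_Icc K y).1)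
    (fun y => (tailInd_mem_Icc K y).2) ht

/-- The skeleton's spelling of stub 6's functional: `E[ζ₀ζ₁] − E[ζ₀]E[ζ₁] = Cov(ζ₀, ζ₁)` (`σ ≤ 1/2`, nice profiles). -/
theorem integral_mul_sub_eq_cov_sojourn {σ : ℝ} {a₀ θ₀ : T3 → ℝ} {u₀ : T3 → V3} (hnp : NiceProfiles a₀ θ₀ u₀)
    (hσ2 : σ ≤ 1 / 2) (N : ℕ) (Φ : Flow σ N) {t : ℝ} (ht : 0 ≤ t) (K : ℝ) :
    (∫ z, (∫⁻ s in Icc 0 t, ENNReal.ofReal (if K ≤ ‖(Φ.flow s z 0).2‖ ^ 2 then (1 : ℝ) else 0)).toReal *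
          (∫⁻ s in Icc 0 t, ENNReal.ofReal (if K ≤ ‖(Φ.flow s z 1).2‖ ^ 2 then (1 : ℝ) else 0)).toReal
          ∂(localGibbsLaw σ a₀ u₀ θ₀ N Φ)) -
        (∫ z, (∫⁻ s in Icc 0 t, ENNReal.ofReal (if K ≤ ‖(Φ.flow s z 0).2‖ ^ 2 then (1 : ℝ) else 0)).toReal
          ∂(localGibbsLaw σ a₀ u₀ θ₀ N Φ)) *
        (∫ z, (∫⁻ s in Icc 0 t, ENNReal.ofReal (if K ≤ ‖(Φ.flow s z 1).2‖ ^ 2 then (1 : ℝ) else 0)).toReal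
          ∂(localGibbsLaw σ a₀ u₀ θ₀ N Φ)) =
      cov[fun z => (∫⁻ s in Icc 0 t, ENNReal.ofReal (if K ≤ ‖(Φ.flow s z 0).2‖ ^ 2 then (1 : ℝ) else 0)).toReal,
        fun z => (∫⁻ s in Icc 0 t, ENNReal.ofReal (if K ≤ ‖(Φ.flow s z 1).2‖ ^ 2 then (1 : ℝ) else 0)).toReal;
        localGibbsLaw σ a₀ u₀ θ₀ N Φ] := by
  obtain ⟨ha, hθ, hu, ha0, hθ0⟩ := hnp
  haveI := isProbabilityMeasure_localGibbsLaw ha hθ hu ha0 hθ0 hσ2 N Φ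
  have hmem := fun i => memLp_sojourn Φ (measurable_tailInd K) (fun y => (tailInd_mem_Icc K y).2) ht
    (localGibbsLaw_compl_good σ a₀ θ₀ u₀ N Φ) i
  rw [covariance_eq_sub (hmem 0) (hmem 1)]
  rfl

/-- **`Var occ_K ≤ t²/(4(N+1)) + |Cov(ζ₀, ζ₁)|`** (`σ ≤ 1/2`, nice profiles, every flow, `t ≥ 0`, `K`, `N`): x1 + Popoviciu. -/
theorem variance_occ_le_diag_add_abs_cov {σ : ℝ} {a₀ θ₀ : T3 → ℝ} {u₀ : T3 → V3} (hnp : NiceProfiles a₀ θ₀ u₀)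
    (hσ2 : σ ≤ 1 / 2) (N : ℕ) (Φ : Flow σ N) {t : ℝ} (ht : 0 ≤ t) (K : ℝ) :
    Var[fun z => (∫⁻ s in Icc 0 t, ENNReal.ofReal (frac K (Φ.flow s z))).toReal; localGibbsLaw σ a₀ u₀ θ₀ N Φ] ≤
      t ^ 2 / (4 * ((N + 1 : ℕ) : ℝ)) +
        |cov[fun z => (∫⁻ s in Icc 0 t, ENNReal.ofReal (if K ≤ ‖(Φ.flow s z 0).2‖ ^ 2 then (1 : ℝ) else 0)).toReal,
          fun z => (∫⁻ s in Icc 0 t, ENNReal.ofReal (if K ≤ ‖(Φ.flow s z 1).2‖ ^ 2 then (1 : ℝ) else 0)).toReal;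
          localGibbsLaw σ a₀ u₀ θ₀ N Φ]| := by
  obtain ⟨ha, hθ, hu, ha0, hθ0⟩ := hnp
  haveI := isProbabilityMeasure_localGibbsLaw ha hθ hu ha0 hθ0 hσ2 N Φ
  exact le_of_avg_identity (variance_occ_eq_diag_add_cov ⟨ha, hθ, hu, ha0, hθ0⟩ hσ2 N Φ ht K)
    (variance_sojourn_le Φ (measurable_tailInd K) (fun y => (tailInd_mem_Icc K y).2) ht
      (localGibbsLaw_compl_good σ a₀ θ₀ u₀ N Φ) 0)

/-- STUB `stub_occupationVariance_of_pairDecorrelation` of the line `meso-chebyshev-window` (registered stub 7 of the r3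
skeleton of `AprioriBounds_of`; PROVED — the exchangeability glue of the (i)-half).  For `0 < σ ≤ 1/2` (probability
laws), nice profiles, `t > 0`, ANY flow family and every level `K`: if the tail sojourns `ζᵢ = ∫₀ᵗ 𝟙{K ≤ |vᵢ(s)|²} ds`
of the two tagged spheres `0` and `1` decorrelate, `E[ζ₀ζ₁] − E[ζ₀]E[ζ₁] → 0` (stub 6's conclusion at `K`), then
`Var_{P_N} occ_K → 0` for `occ_K = ∫₀ᵗ frac_K(Φ_s ·) ds` (`Var occ_K ≤ t²/(4(N+1)) + |Cov(ζ₀, ζ₁)|`: window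
exchangeability of the evolved local Gibbs law + Bienaymé + Popoviciu; squeeze). -/
theorem stub_occupationVariance_of_pairDecorrelation :
    ∀ (σ : ℝ) (a₀ θ₀ : T3 → ℝ) (u₀ : T3 → V3)
      (Φ : (N : ℕ) → HardSphereFlow (Torus.geometry (Fin 3)) (hsDiameter σ N) (N + 1)) (t : ℝ),
      0 < σ → σ ≤ 1 / 2 → NiceProfiles a₀ θ₀ u₀ → 0 < t →
      ∀ K : ℝ,
        Tendsto (fun N : ℕ =>
          (∫ z, (∫⁻ s in Icc 0 t, ENNReal.ofReal (if K ≤ ‖((Φ N).flow s z 0).2‖ ^ 2 then (1 : ℝ) else 0)).toReal *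
              (∫⁻ s in Icc 0 t, ENNReal.ofReal (if K ≤ ‖((Φ N).flow s z 1).2‖ ^ 2 then (1 : ℝ) else 0)).toReal
              ∂(localGibbsLaw σ a₀ u₀ θ₀ N (Φ N))) -
            (∫ z, (∫⁻ s in Icc 0 t, ENNReal.ofReal (if K ≤ ‖((Φ N).flow s z 0).2‖ ^ 2 then (1 : ℝ) else 0)).toReal
              ∂(localGibbsLaw σ a₀ u₀ θ₀ N (Φ N))) *
            (∫ z, (∫⁻ s in Icc 0 t, ENNReal.ofReal (if K ≤ ‖((Φ N).flow s z 1).2‖ ^ 2 then (1 : ℝ) else 0)).toReal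
              ∂(localGibbsLaw σ a₀ u₀ θ₀ N (Φ N)))) atTop (𝓝 0) →
        Tendsto (fun N : ℕ => variance
          (fun z => (∫⁻ s in Icc 0 t, ENNReal.ofReal (frac K ((Φ N).flow s z))).toReal)
          (localGibbsLaw σ a₀ u₀ θ₀ N (Φ N))) atTop (𝓝 0) := by
  intro σ a₀ θ₀ u₀ Φ t _hσ hσ2 hnp ht K hcov
  have hc := (hcov.congr fun N => integral_mul_sub_eq_cov_sojourn hnp hσ2 N (Φ N) ht.le K).abs
  refine squeeze_zero (fun N => variance_nonneg _ _)
    (fun N => variance_occ_le_diag_add_abs_cov hnp hσ2 N (Φ N) ht.le K) ?_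
  have h4 : Tendsto (fun N : ℕ => t ^ 2 / (4 * ((N + 1 : ℕ) : ℝ))) atTop (𝓝 0) := by
    refine ((tendsto_const_div_atTop_nhds_zero_nat (t ^ 2 / 4)).comp (tendsto_add_atTop_nat 1)).congr fun N => ?_
    simp only [Function.comp_apply]
    rw [div_div]
  simpa only [abs_zero, add_zero] using h4.add hc

/-- **x2 · THE CONVERSE.**  For `σ ≤ 1/2`, nice profiles, `t ≥ 0`, any flow family, every `K`: `Var_{P_N} occ_K → 0`
(r2-stub 6 at `K`) implies `E[ζ₀ζ₁] − E[ζ₀]E[ζ₁] → 0` (r3-stub 6 at `K`), by `|Cov(ζ₀, ζ₁)| ≤ 2·Var occ_K + t²/(4N)`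
(`N ≥ 1`, the identity x1).  With the stub: the two stubs 6 are EQUIVALENT level by level under the crux prefix. -/
theorem pairDecorrelation_of_occupationVariance {σ : ℝ} {a₀ θ₀ : T3 → ℝ} {u₀ : T3 → V3}
    (hnp : NiceProfiles a₀ θ₀ u₀) (hσ2 : σ ≤ 1 / 2) (Φ : Flows σ) {t : ℝ} (ht : 0 ≤ t) (K : ℝ)
    (hvar : Tendsto (fun N : ℕ => variance
      (fun z => (∫⁻ s in Icc 0 t, ENNReal.ofReal (frac K ((Φ N).flow s z))).toReal)
      (localGibbsLaw σ a₀ u₀ θ₀ N (Φ N))) atTop (𝓝 0)) :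
    Tendsto (fun N : ℕ =>
      (∫ z, (∫⁻ s in Icc 0 t, ENNReal.ofReal (if K ≤ ‖((Φ N).flow s z 0).2‖ ^ 2 then (1 : ℝ) else 0)).toReal *
          (∫⁻ s in Icc 0 t, ENNReal.ofReal (if K ≤ ‖((Φ N).flow s z 1).2‖ ^ 2 then (1 : ℝ) else 0)).toReal
          ∂(localGibbsLaw σ a₀ u₀ θ₀ N (Φ N))) -
        (∫ z, (∫⁻ s in Icc 0 t, ENNReal.ofReal (if K ≤ ‖((Φ N).flow s z 0).2‖ ^ 2 then (1 : ℝ) else 0)).toReal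
          ∂(localGibbsLaw σ a₀ u₀ θ₀ N (Φ N))) *
        (∫ z, (∫⁻ s in Icc 0 t, ENNReal.ofReal (if K ≤ ‖((Φ N).flow s z 1).2‖ ^ 2 then (1 : ℝ) else 0)).toReal
          ∂(localGibbsLaw σ a₀ u₀ θ₀ N (Φ N)))) atTop (𝓝 0) := by
  have hbound : Tendsto (fun N : ℕ => 2 * variance
      (fun z => (∫⁻ s in Icc 0 t, ENNReal.ofReal (frac K ((Φ N).flow s z))).toReal)
      (localGibbsLaw σ a₀ u₀ θ₀ N (Φ N)) + t ^ 2 / (4 * (N : ℝ))) atTop (𝓝 0) := by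
    simpa only [mul_zero, add_zero] using
      (hvar.const_mul 2).add ((tendsto_const_div_atTop_nhds_zero_nat (t ^ 2 / 4)).congr fun N => by rw [div_div])
  refine squeeze_zero_norm' (eventually_atTop.2 ⟨1, fun N hN => ?_⟩) hbound
  obtain ⟨ha, hθ, hu, ha0, hθ0⟩ := hnp
  haveI := isProbabilityMeasure_localGibbsLaw ha hθ hu ha0 hθ0 hσ2 N (Φ N)
  rw [Real.norm_eq_abs, integral_mul_sub_eq_cov_sojourn ⟨ha, hθ, hu, ha0, hθ0⟩ hσ2 N (Φ N) ht K]
  exact abs_le_of_avg_identity hN (variance_occ_eq_diag_add_cov ⟨ha, hθ, hu, ha0, hθ0⟩ hσ2 N (Φ N) ht K)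
    (variance_nonneg _ _) (variance_nonneg _ _)
    (variance_sojourn_le (Φ N) (measurable_tailInd K) (fun y => (tailInd_mem_Icc K y).2) ht
      (localGibbsLaw_compl_good σ a₀ θ₀ u₀ N (Φ N)) 0)

/-- **x3 · THE EQUILIBRIUM RUNG OF STUB 6 `stub_pairDecorrelation`, FOR EVERY FLOW FAMILY**: at CONSTANT profiles
`(a, θ₀, u₀)`, `a, θ₀ > 0`, `σ ≤ 1/2`, every `t ≥ 0` and level `K`, `E[ζ₀ζ₁] − E[ζ₀]E[ζ₁] → 0` (landed rung
`occupationVariance_tendsto_const`: `Var occ_K ≤ t²/(4(N+1))`, and x2); stub 6's crux prefix is then idle. -/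
theorem pairDecorrelation_homogeneous {σ a θ₀ : ℝ} (u₀ : V3) (hσ2 : σ ≤ 1 / 2) (ha : 0 < a) (hθ : 0 < θ₀)
    (Φ : Flows σ) {t : ℝ} (ht : 0 ≤ t) (K : ℝ) :
    Tendsto (fun N : ℕ =>
      (∫ z, (∫⁻ s in Icc 0 t, ENNReal.ofReal (if K ≤ ‖((Φ N).flow s z 0).2‖ ^ 2 then (1 : ℝ) else 0)).toReal *
          (∫⁻ s in Icc 0 t, ENNReal.ofReal (if K ≤ ‖((Φ N).flow s z 1).2‖ ^ 2 then (1 : ℝ) else 0)).toReal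
          ∂(localGibbsLaw σ (fun _ => a) (fun _ => u₀) (fun _ => θ₀) N (Φ N))) -
        (∫ z, (∫⁻ s in Icc 0 t, ENNReal.ofReal (if K ≤ ‖((Φ N).flow s z 0).2‖ ^ 2 then (1 : ℝ) else 0)).toReal
          ∂(localGibbsLaw σ (fun _ => a) (fun _ => u₀) (fun _ => θ₀) N (Φ N))) *
        (∫ z, (∫⁻ s in Icc 0 t, ENNReal.ofReal (if K ≤ ‖((Φ N).flow s z 1).2‖ ^ 2 then (1 : ℝ) else 0)).toReal
          ∂(localGibbsLaw σ (fun _ => a) (fun _ => u₀) (fun _ => θ₀) N (Φ N)))) atTop (𝓝 0) :=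
  pairDecorrelation_of_occupationVariance ⟨continuous_const, continuous_const, continuous_const, fun _ => ha,
    fun _ => hθ⟩ hσ2 Φ ht K (occupationVariance_tendsto_const u₀ hσ2 ha hθ Φ ht K)

end Summit.AtomisticToContinuum.HydrodynamicLimit.Theorems.MesoChebyshevWindow

end
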